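import Summits.QuantumFields.YangMills.Theorems.BalabanUVNodesK2Line1PrimeRemainderPrice
import Literature.MathematicalPhysics.QuantumFieldTheory.Balaban1983to89.Node00.Record8Chart

/-!
# K2⁷ `EndpointGivenBR13SepCoPH` — NEGATIVE LEMMA on LINE 1′'s stub pair «named jets» (skeleton v3 `stub_remNamedJets13` ∧ `stub_d1NamedJets13`;
  b2b-an4's constant-form pair): FALSE MODULO two admissible chart normalisations

Cell ym-nodeO-ideate, seat CRIT-1 g2 (critic follow-through; sheet `Cruxes/EndpointGivenBR13SepCoPH/CRIT-1-g2-FOLLOWTHROUGH-namedjets-normalisation.md`).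

The registered pair (v3 `D80-K2V3/K2Skeleton13SepCoPHv3.lean` :172–:191, texts spelled INLINE below)
  stub 2′ `∀ F, ∃ κ, ∀ θ (hP : θ.Provisos₁₃SepCoPH F 2), θ.Admissible F 2 → RemAt F κ θ hP`  (ONE colour datum per FAMILY),
  stub 1′ `∀ F κ θ hP, θ.Admissible F 2 → RemAt F κ θ hP → ∃ A, OneLoopDrift (stepBal 2 F.L) A (beta0OfJs F κ)`
is jointly false as soon as ONE family carries two proviso-carrying admissible Stage-13 tuples whose β-functions of record are PROPORTIONAL with a factor
`λ ≠ 1` on a common box (hypothesis spelled inline; NOT constructed here — it needs K0⁷-type inhabitation).  Why that is the generic situation: the record's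
β reads the β-chart through `polScalar ∕ polComp`, BILINEAR in the basis vectors, and Stage-9 admissibility asks only `0 < cβ ∧ IsChartOfRecord cβ` with
`IsSuChart` CLOSED under basis rescaling `b ↦ u•b`, `c ↦ u²·c` (§1) — the normalisation `cβ ∈ ]0,∞[` is free in the class the stubs quantify over, and the
provisos do not read it.  Mechanism (§2–§3): a box remainder's per-scale anchor pins the reference numbers (an4 `eq_of_anchors`); one κ serving both
tuples pins `beta0OfJs F κ` to `b` and `λb`, so `b = 0`, and the zero sequence cannot drift with the positive slope `stepBal 2 F.L`.  Moving `∃ κ` under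
`∀ θ` alone does not repair it (§2 `lam_eq_one_of_drift_and_drift_mul`): the slope letter is itself normalisation-specific; the repair carries `θ.cβ`
(sheet §2).  Nothing of Bałaban's is asserted; K2⁷ stays OPEN; the Clay YM mass gap is NOT proved by any of this (R4 = the conditional finite-𝕋⁴ rung only).
-/

namespace Summit.QuantumFields.YangMills.Theorems.EndpointGivenBR13SepCoPH.Negative.RemNamedJets13FalseOfTwoNormalisations

open Finset
open scoped BigOperators
open Literature.MathematicalPhysics.QuantumFieldTheory.Balaban1983to89
open Literature.MathematicalPhysics.QuantumFieldTheory.Balaban1983to89.FlowStep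
open Literature.MathematicalPhysics.QuantumFieldTheory.Balaban1983to89.T4Continuum (T4Family)
open Literature.MathematicalPhysics.QuantumFieldTheory.Balaban1983to89.B12Beta (HistBox)
open Literature.MathematicalPhysics.QuantumFieldTheory.Balaban1983to89.Node00
open Literature.MathematicalPhysics.QuantumFieldTheory.Balaban1983to89.Beta.Drift (OneLoopDrift)
open Summit.QuantumFields.YangMills.Theorems.BalabanUVNodesK2JsOfRecord (StepColourData beta0OfJs BoxRemainder)
open Summit.QuantumFields.YangMills.Theorems.BalabanUVNodesK2Line1PrimeRemainderPrice (eq_of_anchors anchor_of_boxRemainder)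

/-! ## §1 The chart clause of record is closed under rescaling; the polarisation components are bilinear in the basis -/

section Chart

open Literature.Algebra.Lie.CompactKillingForm (hsForm hsForm_apply)
open Literature.MathematicalPhysics.QuantumFieldTheory.Balaban1983to89.B12PolarizationTensor120 (polTensor polComp polTensor_smul_left polTensor_smul_right)
open Matrix

/-- Rescaling an `IsSuChart`-basis by a unit `u` gives an `IsSuChart`-basis with constant `u²·c`: Stage-9 admissibility (`0 < cβ ∧ IsChartOfRecord cβ`) leaves the
normalisation `cβ ∈ ]0,∞[` free. [cite: Balaban1987RG1, (1.20)–(1.21) p.264 (bookkeeping)] -/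
theorem isSuChart_unitsSMul {N : ℕ} {V : Type*} [NormedAddCommGroup V] [NormedSpace ℝ V] {ι : Type*}
    {ρ : V →L[ℝ] Matrix (Fin N) (Fin N) ℂ} {b : Module.Basis ι ℝ V} {c : ℝ} (h : IsSuChart N ρ b c) (u : ℝˣ) :
    IsSuChart N ρ (b.unitsSMul fun _ => u) ((u : ℝ) ^ 2 * c) := by
  obtain ⟨h1, h2, h3, h4⟩ := h
  have hscale : ∀ a a' : ι, hsForm (Fin N) (ρ (b.unitsSMul (fun _ => u) a)) (ρ (b.unitsSMul (fun _ => u) a')) =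
      (u : ℝ) ^ 2 * hsForm (Fin N) (ρ (b a)) (ρ (b a')) := by
    intro a a'
    simp only [Module.Basis.unitsSMul_apply, Units.smul_def, map_smul, LinearMap.smul_apply, smul_eq_mul]
    ring
  refine ⟨h1, h2, fun a => ?_, fun a a' haa => ?_⟩
  · rw [hscale, h3]
  · rw [hscale, h4 a a' haa, mul_zero]

/-- `Π^{ab}[u•bV] = u²·Π^{ab}[bV]` (bilinearity of (1.20) in the colour directions). [cite: Balaban1987RG1, (1.20) p.264 (bookkeeping)] -/
theorem polComp_unitsSMul {Λ T V F : Type*} [Fintype Λ] [Fintype T] [DecidableEq Λ] [DecidableEq T] [NormedAddCommGroup V] [NormedSpace ℝ V]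
    [NormedAddCommGroup F] [NormedSpace ℝ F] {ι : Type*} (𝓔 : (Λ → T → V) → F) (bV : Module.Basis ι ℝ V) (u : ℝˣ)
    (μ : Λ) (x : T) (a : ι) (ν : Λ) (y : T) (a' : ι) :
    polComp ℝ 𝓔 (bV.unitsSMul fun _ => u) μ x a ν y a' = ((u : ℝ) * u) • polComp ℝ 𝓔 bV μ x a ν y a' := by
  unfold polComp
  rw [Module.Basis.unitsSMul_apply, Module.Basis.unitsSMul_apply, Units.smul_def, Units.smul_def, polTensor_smul_left,
    polTensor_smul_right, smul_smul]

/-- The record's scalar kernel `polScalar` in a rescaled basis is `u²` times the original: the β of record is homogeneous of degree one in the chart normalisation at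
every finite volume. [cite: Balaban1987RG1, (1.20)–(1.22) p.264 (bookkeeping)] -/
theorem polScalar_unitsSMul {Λ T V 𝔄 : Type*} [Fintype Λ] [Fintype T] [DecidableEq Λ] [DecidableEq T] [NormedAddCommGroup V] [NormedSpace ℝ V]
    [NormedRing 𝔄] [NormedAlgebra ℝ 𝔄] [CompleteSpace 𝔄] {ι : Type*} [Fintype ι]
    (ℰ : (Λ → T → 𝔄) → ℝ) (ρ : V →L[ℝ] 𝔄) (bV : Module.Basis ι ℝ V) (u : ℝˣ) (μ : Λ) (x : T) (ν : Λ) (y : T) :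
    polScalar ℰ ρ (bV.unitsSMul fun _ => u) μ x ν y = ((u : ℝ) * u) * polScalar ℰ ρ bV μ x ν y := by
  unfold polScalar
  simp_rw [polComp_unitsSMul, smul_eq_mul]
  rw [← Finset.mul_sum]
  ring

end Chart

/-! ## §2 Two anchors of PROPORTIONAL β's at the same reference sequence force it to vanish; the zero sequence does not drift; a bare quantifier swap is no repair -/

section Logic

variable {β β' : HBeta} {b : ℕ → ℝ}

/-- If `β' = λβ` on a common box, a per-scale anchor of `β` at `b` is a per-scale anchor of `β'` at `λ•b`. [folklore] -/
theorem anchor_of_proportional {lam γ₁ : ℝ} (hγ₁ : 0 < γ₁)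
    (hprop : ∀ (k : ℕ) (p : Fin (k + 1) → ℝ), p ∈ HistBox γ₁ k → β' k p = lam * β k p)
    (h : ∀ (k : ℕ) (δ : ℝ), 0 < δ → ∃ γ : ℝ, 0 < γ ∧ ∀ p : Fin (k + 1) → ℝ, p ∈ HistBox γ k → |β k p - b k| ≤ δ) :
    ∀ (k : ℕ) (δ : ℝ), 0 < δ → ∃ γ : ℝ, 0 < γ ∧ ∀ p : Fin (k + 1) → ℝ, p ∈ HistBox γ k → |β' k p - lam * b k| ≤ δ := by
  intro k δ hδ
  obtain ⟨γ, hγ, hb⟩ := h k (δ / (|lam| + 1)) (by positivity)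
  refine ⟨min γ γ₁, lt_min hγ hγ₁, fun p hp => ?_⟩
  have hpγ : p ∈ HistBox γ k := fun i => ⟨(hp i).1, (hp i).2.trans (min_le_left _ _)⟩
  have hpγ₁ : p ∈ HistBox γ₁ k := fun i => ⟨(hp i).1, (hp i).2.trans (min_le_right _ _)⟩
  rw [hprop k p hpγ₁, ← mul_sub, abs_mul]
  have h1 := hb p hpγ
  have hlam : 0 ≤ |lam| := abs_nonneg _
  calc |lam| * |β k p - b k| ≤ |lam| * (δ / (|lam| + 1)) := mul_le_mul_of_nonneg_left h1 hlam
    _ ≤ (|lam| + 1) * (δ / (|lam| + 1)) := mul_le_mul_of_nonneg_right (by linarith) (by positivity)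
    _ = δ := by field_simp

/-- **★ Anchors of `β` and of `β' = λβ` (`λ ≠ 1`, on a common box) at the SAME `b` force `b = 0`.** [folklore] -/
theorem eq_zero_of_anchors_proportional {lam γ₁ : ℝ} (hlam : lam ≠ 1) (hγ₁ : 0 < γ₁)
    (hprop : ∀ (k : ℕ) (p : Fin (k + 1) → ℝ), p ∈ HistBox γ₁ k → β' k p = lam * β k p)
    (h : ∀ (k : ℕ) (δ : ℝ), 0 < δ → ∃ γ : ℝ, 0 < γ ∧ ∀ p : Fin (k + 1) → ℝ, p ∈ HistBox γ k → |β k p - b k| ≤ δ)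
    (h' : ∀ (k : ℕ) (δ : ℝ), 0 < δ → ∃ γ : ℝ, 0 < γ ∧ ∀ p : Fin (k + 1) → ℝ, p ∈ HistBox γ k → |β' k p - b k| ≤ δ) : b = 0 := by
  have hlamb : (fun k => lam * b k) = b := eq_of_anchors (anchor_of_proportional hγ₁ hprop h) h'
  funext k
  have hk : lam * b k = b k := congrFun hlamb k
  have : (lam - 1) * b k = 0 := by linarith
  rcases mul_eq_zero.mp this with h0 | h0
  · exact absurd (sub_eq_zero.mp h0) hlam
  · exact h0

/-- The ZERO sequence does not drift with a positive slope. [folklore] -/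
theorem not_oneLoopDrift_zero {s : ℝ} (hs : 0 < s) (A : ℝ) : ¬ OneLoopDrift s A 0 := by
  intro h
  obtain ⟨n, hn⟩ := exists_nat_gt (A / s)
  have hk := h n
  simp only [Pi.zero_apply, Finset.sum_const_zero, zero_sub, abs_neg] at hk
  rw [abs_of_nonneg (by positivity)] at hk
  have : A < s * n := by rwa [div_lt_iff₀ hs, mul_comm] at hn
  linarith

/-- A drift survives multiplication by any constant: `c•b` drifts with slope `c·s` up to `|c|·A`. [folklore] -/
theorem oneLoopDrift_const_mul {s A : ℝ} (h : OneLoopDrift s A b) (c : ℝ) : OneLoopDrift (c * s) (|c| * A) (fun k => c * b k) := by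
  intro k
  rw [← Finset.mul_sum, mul_assoc, ← mul_sub, abs_mul]
  exact mul_le_mul_of_nonneg_left (h k) (abs_nonneg c)

/-- **A BARE QUANTIFIER SWAP IS NO REPAIR**: if `b` and `λb` both drift with the same positive slope then `λ = 1` — so per-tuple data whose anchored numbers differ by a factor
`λ ≠ 1` cannot both satisfy a stub 1′ with the fixed slope `stepBal 2 F.L`. [folklore] -/
theorem lam_eq_one_of_drift_and_drift_mul {s A A' lam : ℝ} (hs : 0 < s) (h : OneLoopDrift s A b)
    (h' : OneLoopDrift s A' (fun k => lam * b k)) : lam = 1 := by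
  by_contra hne
  have h1 := oneLoopDrift_const_mul h lam
  have hgap : ∀ k : ℕ, |(lam * s - s) * k| ≤ |lam| * A + A' := fun k => by
    have e1 : |∑ j ∈ Finset.range k, lam * b j - lam * s * k| ≤ |lam| * A := h1 k
    have e2 : |∑ j ∈ Finset.range k, lam * b j - s * k| ≤ A' := h' k
    have e := abs_sub (∑ j ∈ Finset.range k, lam * b j - s * k) (∑ j ∈ Finset.range k, lam * b j - lam * s * k)
    have heq : (lam * s - s) * (k : ℝ) =
        (∑ j ∈ Finset.range k, lam * b j - s * k) - (∑ j ∈ Finset.range k, lam * b j - lam * s * k) := by ring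
    rw [heq]
    linarith
  have hls : lam * s - s ≠ 0 := by
    intro h0; apply hne; have : (lam - 1) * s = 0 := by linarith
    rcases mul_eq_zero.mp this with h | h
    · linarith
    · exact absurd h hs.ne'
  have hpos : 0 < |lam * s - s| := abs_pos.mpr hls
  obtain ⟨n, hn⟩ := exists_nat_gt ((|lam| * A + A') / |lam * s - s|)
  have hk := hgap n
  rw [abs_mul, Nat.abs_cast] at hk
  have : |lam| * A + A' < n * |lam * s - s| := by rwa [div_lt_iff₀ hpos] at hn
  linarith

end Logic

/-! ## §3 The kills at VERBATIM texts, modulo the inline hypothesis «two proviso-carrying admissible tuples with proportional β, factor ≠ 1» -/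

section Kill

/-- **★ `stub_remNamedJets13 ∧ stub_d1NamedJets13` (v3 :181 ∕ :189, letter `RemAt` :172 — texts VERBATIM) IS FALSE MODULO TWO NORMALISATIONS.**  Hypothesis: in some family two
proviso-carrying admissible Stage-13 tuples whose β-functions of record are proportional (factor `λ ≠ 1`) on a common box `]0,γ₁]` — what a basis rescaling `bV ↦ u•bV`,
`cβ ↦ u²cβ` produces wherever the (1.21) limits exist (§1). [cite: Balaban1987RG1, (1.20)–(1.22) p.264 and (2.12)–(2.14) p.268 (bookkeeping)] -/
theorem remNamedJets13_pair_false_of_twoNormalisations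
    (H : ∃ (F : T4Family) (θ θ' : Node00.Stage13HParams F 2) (hP : θ.Provisos₁₃SepCoPH F 2) (hP' : θ'.Provisos₁₃SepCoPH F 2),
      θ.Admissible F 2 ∧ θ'.Admissible F 2 ∧ ∃ lam γ₁ : ℝ, lam ≠ 1 ∧ 0 < γ₁ ∧
        ∀ (k : ℕ) (p : Fin (k + 1) → ℝ), p ∈ HistBox γ₁ k →
          (Node00.datumOfRecord₁₃SepCoPH F 2 θ' hP').βfun k p = lam * (Node00.datumOfRecord₁₃SepCoPH F 2 θ hP).βfun k p) :
    ¬ ((∀ F : T4Family, ∃ κ : StepColourData, ∀ (θ : Node00.Stage13HParams F 2) (hP : θ.Provisos₁₃SepCoPH F 2), θ.Admissible F 2 →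
          ∃ γ₀ Cr β' : ℝ, 0 < γ₀ ∧ γ₀ ≤ θ.γ ∧ 0 ≤ Cr ∧ 0 ≤ β' ∧
            BoxRemainder (Node00.datumOfRecord₁₃SepCoPH F 2 θ hP).βfun (beta0OfJs F κ) Cr γ₀ ∧
            Cr * γ₀ ≤ B12Normalization.stepBal 2 F.L ∧
            BetaContH γ₀ (Node00.datumOfRecord₁₃SepCoPH F 2 θ hP).βfun ∧
            BetaUpperH β' γ₀ (Node00.datumOfRecord₁₃SepCoPH F 2 θ hP).βfun) ∧
       (∀ (F : T4Family) (κ : StepColourData) (θ : Node00.Stage13HParams F 2) (hP : θ.Provisos₁₃SepCoPH F 2), θ.Admissible F 2 →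
          (∃ γ₀ Cr β' : ℝ, 0 < γ₀ ∧ γ₀ ≤ θ.γ ∧ 0 ≤ Cr ∧ 0 ≤ β' ∧
            BoxRemainder (Node00.datumOfRecord₁₃SepCoPH F 2 θ hP).βfun (beta0OfJs F κ) Cr γ₀ ∧
            Cr * γ₀ ≤ B12Normalization.stepBal 2 F.L ∧
            BetaContH γ₀ (Node00.datumOfRecord₁₃SepCoPH F 2 θ hP).βfun ∧
            BetaUpperH β' γ₀ (Node00.datumOfRecord₁₃SepCoPH F 2 θ hP).βfun) →
          ∃ A : ℝ, OneLoopDrift (B12Normalization.stepBal 2 F.L) A (beta0OfJs F κ))) := by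
  rintro ⟨h₂, h₁⟩
  obtain ⟨F, θ, θ', hP, hP', hθ, hθ', lam, γ₁, hlam, hγ₁, hprop⟩ := H
  obtain ⟨κ, hκ⟩ := h₂ F
  have hR := hκ θ hP hθ
  have hR' := hκ θ' hP' hθ'
  obtain ⟨A, hdrift⟩ := h₁ F κ θ hP hθ hR
  obtain ⟨γ₀, Cr, β', hγ₀, -, hCr, -, hrem, -, -, -⟩ := hR
  obtain ⟨γ₀', Cr', β'', hγ₀', -, hCr', -, hrem', -, -, -⟩ := hR'
  have hb : beta0OfJs F κ = 0 :=
    eq_zero_of_anchors_proportional hlam hγ₁ hprop (anchor_of_boxRemainder hrem hCr hγ₀) (anchor_of_boxRemainder hrem' hCr' hγ₀')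
  rw [hb] at hdrift
  exact not_oneLoopDrift_zero (B12Normalization.stepBal_pos two_pos (by exact_mod_cast F.hL.2)) A hdrift

/-- **★ The same at b2b-an4's CONSTANT-FORM pair** (`RemAtC` = p590583 `remAtC_of_remAt`'s conclusion, quantified `∀ F, ∃ κ, ∀ θ`): the per-scale ANCHOR conjunct alone carries the
kill. [cite: Balaban1987RG1, (1.20)–(1.22) p.264 and (2.13) p.268 (bookkeeping)] -/
theorem remNamedJetsC_pair_false_of_twoNormalisations
    (H : ∃ (F : T4Family) (θ θ' : Node00.Stage13HParams F 2) (hP : θ.Provisos₁₃SepCoPH F 2) (hP' : θ'.Provisos₁₃SepCoPH F 2),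
      θ.Admissible F 2 ∧ θ'.Admissible F 2 ∧ ∃ lam γ₁ : ℝ, lam ≠ 1 ∧ 0 < γ₁ ∧
        ∀ (k : ℕ) (p : Fin (k + 1) → ℝ), p ∈ HistBox γ₁ k →
          (Node00.datumOfRecord₁₃SepCoPH F 2 θ' hP').βfun k p = lam * (Node00.datumOfRecord₁₃SepCoPH F 2 θ hP).βfun k p) :
    ¬ ((∀ F : T4Family, ∃ κ : StepColourData, ∀ (θ : Node00.Stage13HParams F 2) (hP : θ.Provisos₁₃SepCoPH F 2), θ.Admissible F 2 →
          ∃ γ₀ s β' : ℝ, 0 < γ₀ ∧ γ₀ ≤ θ.γ ∧ 0 ≤ s ∧ s ≤ B12Normalization.stepBal 2 F.L ∧ 0 ≤ β' ∧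
            (∀ (k : ℕ) (p : Fin (k + 1) → ℝ), p ∈ HistBox γ₀ k → |(Node00.datumOfRecord₁₃SepCoPH F 2 θ hP).βfun k p - beta0OfJs F κ k| ≤ s) ∧
            (∀ (k : ℕ) (δ : ℝ), 0 < δ → ∃ γ : ℝ, 0 < γ ∧ ∀ p : Fin (k + 1) → ℝ, p ∈ HistBox γ k →
              |(Node00.datumOfRecord₁₃SepCoPH F 2 θ hP).βfun k p - beta0OfJs F κ k| ≤ δ) ∧
            BetaContH γ₀ (Node00.datumOfRecord₁₃SepCoPH F 2 θ hP).βfun ∧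
            BetaUpperH β' γ₀ (Node00.datumOfRecord₁₃SepCoPH F 2 θ hP).βfun) ∧
       (∀ (F : T4Family) (κ : StepColourData) (θ : Node00.Stage13HParams F 2) (hP : θ.Provisos₁₃SepCoPH F 2), θ.Admissible F 2 →
          (∃ γ₀ s β' : ℝ, 0 < γ₀ ∧ γ₀ ≤ θ.γ ∧ 0 ≤ s ∧ s ≤ B12Normalization.stepBal 2 F.L ∧ 0 ≤ β' ∧
            (∀ (k : ℕ) (p : Fin (k + 1) → ℝ), p ∈ HistBox γ₀ k → |(Node00.datumOfRecord₁₃SepCoPH F 2 θ hP).βfun k p - beta0OfJs F κ k| ≤ s) ∧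
            (∀ (k : ℕ) (δ : ℝ), 0 < δ → ∃ γ : ℝ, 0 < γ ∧ ∀ p : Fin (k + 1) → ℝ, p ∈ HistBox γ k →
              |(Node00.datumOfRecord₁₃SepCoPH F 2 θ hP).βfun k p - beta0OfJs F κ k| ≤ δ) ∧
            BetaContH γ₀ (Node00.datumOfRecord₁₃SepCoPH F 2 θ hP).βfun ∧
            BetaUpperH β' γ₀ (Node00.datumOfRecord₁₃SepCoPH F 2 θ hP).βfun) →
          ∃ A : ℝ, OneLoopDrift (B12Normalization.stepBal 2 F.L) A (beta0OfJs F κ))) := by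
  rintro ⟨h₂, h₁⟩
  obtain ⟨F, θ, θ', hP, hP', hθ, hθ', lam, γ₁, hlam, hγ₁, hprop⟩ := H
  obtain ⟨κ, hκ⟩ := h₂ F
  have hR := hκ θ hP hθ
  have hR' := hκ θ' hP' hθ'
  obtain ⟨A, hdrift⟩ := h₁ F κ θ hP hθ hR
  obtain ⟨γ₀, s, β', -, -, -, -, -, -, hanc, -, -⟩ := hR
  obtain ⟨γ₀', s', β'', -, -, -, -, -, -, hanc', -, -⟩ := hR'
  have hb : beta0OfJs F κ = 0 := eq_zero_of_anchors_proportional hlam hγ₁ hprop hanc hanc'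
  rw [hb] at hdrift
  exact not_oneLoopDrift_zero (B12Normalization.stepBal_pos two_pos (by exact_mod_cast F.hL.2)) A hdrift

end Kill

end Summit.QuantumFields.YangMills.Theorems.EndpointGivenBR13SepCoPH.Negative.RemNamedJets13FalseOfTwoNormalisations
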